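import Mathlib
import Literature.MathematicalPhysics.QuantumLattice.WilsonDiracAP
import Literature.MathematicalPhysics.QuantumLattice.OverlapLocality
import Literature.Analysis.Matrix.HadamardInequality
import HarnessLib

/-!
# Pathwise determinant bound for the antiperiodic Wilson–Dirac operator
(stub `stub_detBound` of crux stmt-QuantumFields-9735, line Sketch)

`‖det D_AP[U, m]‖ ≤ (|m + 4| + 96) ^ (12 L⁴)` for every `SU(3)` lattice gauge field `U` on the
four-torus `(ℤ/Lℤ)⁴` and every real mass `m`.

Proof: Hadamard's inequality (`Literature.Analysis.Matrix.norm_det_sq_le_prod_sum_sq`) applied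
to `Aᴴ` gives `‖det A‖ ≤ ‖A‖ ^ n` for the `ℓ²` operator norm (`norm_det_le_l2_opNorm_pow`: the
`i`-th row of `Aᴴ` has the Euclidean norm of the column `A e_i`, which is `≤ ‖A‖`); the tree's
HJL bound `‖D_W‖ ≤ |m + 4| + 4` (`l2_opNorm_wilsonDirac_le`) and
`card (TorusSite 4 L × Fin 3 × Fin 4) = 12 L⁴` finish, since `4 ≤ 96`.
-/

noncomputable section

open MeasureTheory Matrix Complex Finset
open Literature.MathematicalPhysics.QuantumFieldTheory Literature.MathematicalPhysics.QuantumLattice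
open scoped ComplexConjugate BigOperators ComplexOrder

namespace Summit.QuantumFields.QCD.Theorems.UnquenchedChessboardBoundLine

open scoped Matrix.Norms.L2Operator

/-- Column `ℓ²` norms are bounded by the `ℓ²` operator norm: `∑ⱼ ‖A j i‖² ≤ ‖A‖²`
(the column is `A e_i` and `‖e_i‖ = 1`). [folklore] -/
theorem sum_norm_sq_col_le_l2_opNorm_sq {n : Type*} [Fintype n] [DecidableEq n]
    (A : Matrix n n ℂ) (i : n) : ∑ j, ‖A j i‖ ^ 2 ≤ ‖A‖ ^ 2 := by
  have h := Matrix.l2_opNorm_mulVec A (EuclideanSpace.single i (1 : ℂ))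
  rw [PiLp.norm_single, norm_one, mul_one] at h
  have hcol : ∑ j, ‖A j i‖ ^ 2 =
      ‖(EuclideanSpace.equiv n ℂ).symm (A *ᵥ ⇑(EuclideanSpace.single i (1 : ℂ)))‖ ^ 2 := by
    rw [EuclideanSpace.norm_sq_eq]
    refine Finset.sum_congr rfl fun j _ => ?_
    simp
  rw [hcol]
  exact pow_le_pow_left₀ (norm_nonneg _) h 2

/-- **Hadamard bound by the operator norm**: `‖det A‖ ≤ ‖A‖ ^ n` for a complex `n × n` matrix
and the `ℓ²` operator norm. [folklore] -/
theorem norm_det_le_l2_opNorm_pow {n : Type*} [Fintype n] [DecidableEq n] (A : Matrix n n ℂ) :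
    ‖A.det‖ ≤ ‖A‖ ^ Fintype.card n := by
  have hsq : ‖A.det‖ ^ 2 ≤ (‖A‖ ^ Fintype.card n) ^ 2 := by
    calc ‖A.det‖ ^ 2 = ‖Aᴴ.det‖ ^ 2 := by rw [Matrix.det_conjTranspose, norm_star]
      _ ≤ ∏ i, ∑ j, ‖Aᴴ i j‖ ^ 2 := Literature.Analysis.Matrix.norm_det_sq_le_prod_sum_sq Aᴴ
      _ = ∏ i, ∑ j, ‖A j i‖ ^ 2 := by simp [Matrix.conjTranspose_apply]
      _ ≤ ∏ _i : n, ‖A‖ ^ 2 := Finset.prod_le_prod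
          (fun i _ => Finset.sum_nonneg fun j _ => by positivity)
          (fun i _ => sum_norm_sq_col_le_l2_opNorm_sq A i)
      _ = (‖A‖ ^ Fintype.card n) ^ 2 := by
          rw [Finset.prod_const, Finset.card_univ, ← pow_mul, ← pow_mul, mul_comm]
  exact (pow_le_pow_iff_left₀ (norm_nonneg _) (by positivity) two_ne_zero).1 hsq

/-- The fermion index set of the four-torus with three colours and four spins has `12 L⁴`
elements. [folklore] -/
theorem card_fermionIndex (L : ℕ) [NeZero L] :
    Fintype.card (Literature.Probability.LatticeModels.TorusSite 4 L × Fin 3 × Fin 4) =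
      12 * L ^ 4 := by
  simp only [Fintype.card_prod, Fintype.card_fun, ZMod.card, Fintype.card_fin]
  ring

/-- **Stub `detBound`.** For every `SU(3)` gauge field on the four-torus and every real mass,
`|det D_AP[U, m]| ≤ (|m + 4| + 96)^{12 L⁴}`: Hadamard's inequality in operator-norm form
`‖det A‖ ≤ ‖A‖ ^ n` (`norm_det_le_l2_opNorm_pow`, from the tree's
`Literature.Analysis.Matrix.norm_det_sq_le_prod_sum_sq`), the HJL bound
`‖D_W[V, m]‖ ≤ |m + 4| + 4` for the unitary field `V = apLift U` (`l2_opNorm_wilsonDirac_le`),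
and `n = 12 L⁴`, `4 ≤ 96`. -/
theorem stub_detBound {L : ℕ} [NeZero L]
    (U : GaugeConfig 4 L (Matrix.specialUnitaryGroup (Fin 3) ℂ)) (m : ℝ) :
    ‖(wilsonDiracAP U m).det‖ ≤ (|m + 4| + 96) ^ (12 * L ^ 4) := by
  have hop : ‖wilsonDiracAP U m‖ ≤ |m + 4| + 4 := by
    rw [wilsonDiracAP_def]
    exact l2_opNorm_wilsonDirac_le _ unitaryFundamentalRep_mem_unitaryGroup _ m
  calc ‖(wilsonDiracAP U m).det‖
      ≤ ‖wilsonDiracAP U m‖ ^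
          Fintype.card (Literature.Probability.LatticeModels.TorusSite 4 L × Fin 3 × Fin 4) :=
        norm_det_le_l2_opNorm_pow _
    _ = ‖wilsonDiracAP U m‖ ^ (12 * L ^ 4) := by rw [card_fermionIndex]
    _ ≤ (|m + 4| + 4) ^ (12 * L ^ 4) := pow_le_pow_left₀ (norm_nonneg _) hop _
    _ ≤ (|m + 4| + 96) ^ (12 * L ^ 4) :=
        pow_le_pow_left₀ (by positivity) (by linarith [abs_nonneg (m + 4)]) _

end Summit.QuantumFields.QCD.Theorems.UnquenchedChessboardBoundLine

end
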